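import Literature.Probability.Percolation.TrapFenceAttach
import Literature.Probability.Percolation.IntTermFence
import HarnessLib

/-!
# Fences of the rerouted members at internal extremities: attachment and no invasion (twin of `TrapFenceAttach.lean`)

Topic: Probability / Percolation; family `crit-perc` (site percolation on the triangular lattice
`𝕋 = triGraph`). The INNER twin of `TrapFenceAttach.lean`: the same four statements for the
exploration domain of internal extremities `HalfAnnulus.intDom m` (the half-annulus
`{x₀ ≥ 0, m ≤ |x| ≤ 2m}`, tips on the side `x₀ = m` of `∂Λ_m`, fences INSIDE `Λ_m`), for members
that now live OUTSIDE `Λ_m` (sets of sites of norm `≥ m`, started at a site of norm `> 2m`, e.g.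
an outer-landed arm read from its outer end) — Nolin 2008, Thm. 11, internal extremities
[arXiv 0711.4948: Thm. 10, p. 13], after Kesten–Sidoravicius–Zhang 1998, App. §7:

* `JDomain.Transversal.int_termFence_q_mem_reroute` — the inner fence of the term chosen for a
  member, stopped at the term, attaches to the rerouted member;
* `JDomain.Transversal.int_not_mem_reroute_of_mem_termFence` — it misses the rerouted member;
* `JDomain.Transversal.int_not_mem_of_mem_termFence` — NO INVASION: it misses every open
  `𝕋`-connected set of sites of norm `≥ m` started outside `Λ_{2m}` and disjoint from the
  rerouted member (the other members of the final family);
* `intTermFence_disjoint_of_lt`, `intTermFence_not_mem_term` — fences of distinct terms of one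
  frame are disjoint and miss the other terms.

The proofs are those of `TrapFenceAttach.lean` with the inner rings (`IntRawOK.inner_ring`,
`outer_ring`, `row_gap`, `IntTermFence.not_mem_of_offLower`), the inner exit lemma
(`IntTermFence.exists_exit`) and the inner geometry (`intDom_entry`: a set of sites of norm `≥ m`
enters the half-annulus only through its start set; `mem_intDom_J_of_near_tip`).

## References

* P. Nolin, *Near-critical percolation in two dimensions*, Electron. J. Probab. 13 (2008), §4.4,
  Lemma 15 and Thm. 11 (proofs), internal extremities [arXiv 0711.4948: Lemma 14, Thm. 10,
  p. 13]. [Nolin2008]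
* H. Kesten, V. Sidoravicius, Y. Zhang, *Almost all words are seen in critical site percolation
  on the triangular lattice*, Electron. J. Probab. 3 (1998), paper 10, App. §7 (7.9), p. 27.
  [KestenSidoraviciusZhang1998]
* H. Kesten, *Scaling relations for 2D-percolation*, Comm. Math. Phys. 109 (1987), Lemma 2.
  [Kesten1987]
-/

noncomputable section

namespace Literature.Probability.Percolation

open LatticeModels HalfAnnulus

open JDomain

/-! ### Inner geometry -/

section Geometry

variable {m k : ℕ}

/-- **A set of sites of norm `≥ m` enters the half-annulus only through its start set** (the cut
rays `x₀ = 0` or the outer boundary `|x| = 2m`). [folklore] -/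
theorem intDom_entry {A : Set (Site 2)} (hA : ∀ v ∈ A, (m : ℤ) ≤ triNorm v) :
    ∀ p ∈ A, ∀ q, p ∉ (intDom m).D → q ∈ (intDom m).D → triGraph.Adj p q → q ∈ (intDom m).F := by
  intro p hp q hpD hqD hpq
  rw [intDom_D] at hpD hqD
  obtain ⟨hq0, hqm, hq2⟩ := mem_haFin.1 hqD
  have hpn := hA p hp
  have h1 := triNorm_le_triNorm_add_one_of_adj hpq
  have h2 := triNorm_le_triNorm_add_one_of_adj hpq.symm
  have h0 := triGraph_adj_coord hpq 0
  refine mem_intDom_F.2 ⟨hqD, ?_⟩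
  by_cases hp0 : 0 ≤ p 0
  · have : ¬ triNorm p ≤ 2 * m := fun h => hpD (mem_haFin.2 ⟨hp0, hpn, h⟩)
    right; omega
  · left; omega

/-- A site of norm `> 2m` is off the half-annulus. [folklore] -/
theorem not_mem_intDom_D_of_gt {a : Site 2} (ha : 2 * (m : ℤ) < triNorm a) : a ∉ (intDom m).D := by
  rw [intDom_D]
  intro h
  have := (mem_haFin.1 h).2.2
  omega

/-- A site of norm `> 2m` is outside the `7k`-box about a tip of the inner side (`14k ≤ m`). [folklore] -/
theorem int_far_of_triNorm_gt (hkm : 14 * k ≤ m) {z : Site 2} (hz : IsIntJ m z) {t : Site 2} (ht : 2 * (m : ℤ) < triNorm t) :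
    t 0 ≤ z 0 - 7 * k ∨ z 0 + 7 * k ≤ t 0 ∨ t 1 ≤ z 1 - 7 * k ∨ z 1 + 7 * k ≤ t 1 := by
  obtain ⟨hz0, hz1, hz2⟩ := hz
  have hkm' : 14 * (k : ℤ) ≤ m := by exact_mod_cast hkm
  rw [triNorm_eq_max] at ht
  simp only [lt_max_iff] at ht
  omega

/-- A site of norm `≥ m` in the `7k`-box about a tip of the inner side lies in the half-annulus
(`14k ≤ m`). [folklore] -/
theorem mem_haFin_of_near (hkm : 14 * k ≤ m) {z : Site 2} (hz : IsIntJ m z) {v : Site 2} (hvn : (m : ℤ) ≤ triNorm v)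
    (hbox : z 0 - 7 * k < v 0 ∧ v 0 < z 0 + 7 * k ∧ z 1 - 7 * k < v 1 ∧ v 1 < z 1 + 7 * k) : v ∈ haFin m := by
  obtain ⟨hz0, hz1, hz2⟩ := hz
  have hkm' : 14 * (k : ℤ) ≤ m := by exact_mod_cast hkm
  refine mem_haFin.2 ⟨by omega, hvn, ?_⟩
  rw [triNorm_eq_max]
  simp only [max_le_iff]
  omega

/-- **A half-annulus site of norm `m` within `2k + 2` rows of an `8k`-middle tip lies on the tip
arc.** [folklore] -/
theorem mem_intDom_J_of_near_tip {x : Site 2} (hxT : x ∈ haFin m) (hxb : triNorm x = m) {z : Site 2} (hz : IsIntJ m z)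
    (hz8 : -(m : ℤ) + 8 * k < z 1 ∧ z 1 + 8 * k < 0) (hk : 1 ≤ k)
    (hnear : z 1 - (2 * k + 2) ≤ x 1 ∧ x 1 ≤ z 1 + (2 * k + 2)) : x ∈ (intDom m).J := by
  obtain ⟨hz0, hz1, hz2⟩ := hz
  have hk' : (1 : ℤ) ≤ k := by exact_mod_cast hk
  have hx0 := (mem_haFin.1 hxT).1
  refine mem_intDom_J.2 ⟨hxT, ?_, by omega, by omega⟩
  rw [triNorm_eq_max] at hxb
  have h1 := le_max_left (max (x 0) (-x 0)) (max (max (x 1) (-x 1)) (max (x 0 + x 1) (-(x 0 + x 1))))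
  rw [hxb] at h1
  have h2 := hxb.le
  simp only [max_le_iff] at h2
  omega

end Geometry

variable {m k : ℕ} {ω : SiteConfig (Site 2)} {u : ℕ} {c : Finset (Site 2)} {z : Site 2}

namespace JDomain.Transversal

variable (τ : (intDom m).Transversal ω)

/-- **No junction near a fenced tip, above its term** (inner twin of `not_mem_T_near_tip`):
`64k < m`. [cite: Nolin2008, §4.4 Lemma 15 (proof), internal extremities (arXiv 0711.4948: Lemma 14)] -/
theorem int_not_mem_T_near_tip (hm : 5 ≤ m) (hu : (intDom m).lowestSeq ω u = some (c, z)) (hraw : IntRawOK m c z k ω)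
    (hk : 1 ≤ k) (hkm : 64 * k < m) {v : Site 2} (hva : v ∈ (intDom m).above c z) (hvω : v ∈ ω)
    (hbox : z 0 - 17 * k ≤ v 0 ∧ v 0 ≤ z 0 + 17 * k ∧ z 1 - 17 * k ≤ v 1 ∧ v 1 ≤ z 1 + 17 * k) : v ∉ τ.T := by
  intro hvT
  have hcut := intDom_cutProp hm
  obtain ⟨w, c', z', hw, hvj⟩ := τ.eq_jn_of_mem _ hvT hvω
  have hjc' : v ∈ c' := hvj ▸ (τ.jn_mem w c' z' hw).1
  rcases lt_trichotomy w u with hlt | rfl | hgt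
  · exact (JDomain.mem_below.1 (JDomain.lowestSeq_subset_below_of_lt hcut hlt hw hu hjc')).2.2 hva
  · rw [hu] at hw
    obtain ⟨rfl, rfl⟩ := Prod.mk.inj (Option.some.inj hw)
    exact JDomain.not_mem_of_mem_above hva hjc'
  · have hc := (JDomain.isCrossing_of_lowestSeq hu).1
    obtain ⟨hc', hc'ω⟩ := JDomain.isCrossing_of_lowestSeq hw
    have habove : c' ⊆ (intDom m).above c z := JDomain.lowestSeq_subset_above_of_lt hcut hgt hu hw
    have hoff : ∀ x ∈ c', x ∉ (intDom m).lower c z := fun x hx hxl =>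
      (JDomain.mem_lower_iff_not_mem_above (hc'.subset hx)).1 hxl (habove hx)
    obtain ⟨f, hfc', hfF⟩ := hc'.exists_start
    obtain ⟨hz0, hz1, hz2⟩ := tip_isIntJ hc
    have hfar := start_far_from_ends (R := 16 * k) (by omega) hfF (z 1) ⟨by omega, by omega⟩
    have hA : (↑c' : Set (Site 2)) ⊆ ((↑((intDom m).lower c z) : Set (Site 2))ᶜ ∩ ω) :=
      fun x hx => ⟨fun h => hoff x (Finset.mem_coe.1 hx) (Finset.mem_coe.1 h), hc'ω hx⟩
    exact hraw.not_box17_of_offLower hk hA (hc'.conn _ hjc' f hfc') (by push_cast at hfar ⊢; omega) hbox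

/-- **The half-annulus sites of the inner fence of a fenced term lie right of `τ`** (inner twin
of `isRight_of_mem_termFence`). [cite: KestenSidoraviciusZhang1998, App. §7 p. 27] -/
theorem int_isRight_of_mem_termFence (hm : 5 ≤ m) (hu : (intDom m).lowestSeq ω u = some (c, z))
    (hraw : IntRawOK m c z k ω) (hk : 1 ≤ k) (hkm : 64 * k < m) (hz8 : -(m : ℤ) + 8 * k < z 1 ∧ z 1 + 8 * k < 0)
    (Tf : IntTermFence m c z k ω ↑c) {x : Site 2} (hx : x ∈ Tf.F) (hxn : (m : ℤ) ≤ triNorm x) : τ.IsRight x := by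
  have hc := (JDomain.isCrossing_of_lowestSeq hu).1
  have hz := tip_isIntJ hc
  have hk' : (1 : ℤ) ≤ k := by exact_mod_cast hk
  have htk : -(m : ℤ) + 2 * k + 1 ≤ z 1 ∧ z 1 ≤ -(2 * (k : ℤ) + 1) := by constructor <;> omega
  obtain ⟨x', e, hx'n, hen, -, hadj, hpath⟩ := Tf.exists_exit hk hz htk hx hxn
  have hx'F : x' ∈ Tf.F := hpath.right_mem.2
  have hx'T : x' ∈ haFin m := (mem_intFenceSet_inside (Tf.F_subset hx'F) hx'n).1
  have hx'b : triNorm x' = m := by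
    have := triNorm_le_triNorm_add_one_of_adj hadj.symm
    omega
  have hbx := intFenceSet_box (Tf.F_subset hx'F)
  have hx'J : x' ∈ (intDom m).J := mem_intDom_J_of_near_tip hx'T hx'b hz hz8 hk ⟨by omega, by omega⟩
  have hsub : {v | (m : ℤ) ≤ triNorm v} ∩ Tf.F ⊆ ((↑(intDom m).D : Set (Site 2)) \ τ.T) := by
    rintro v ⟨hvn, hvF⟩
    have hin := mem_intFenceSet_inside (Tf.F_subset hvF) hvn
    have hvb := intFenceSet_box (Tf.F_subset hvF)
    refine ⟨?_, τ.int_not_mem_T_near_tip hm hu hraw hk hkm hin.2.1 (intFenceSet_subset (Tf.F_subset hvF))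
      ⟨by omega, by omega, by omega, by omega⟩⟩
    rw [intDom_D]
    exact Finset.mem_coe.2 hin.1
  exact ⟨x', hx'J, hpath.mono hsub⟩

/-- **The inner fence of the term of a rerouted member attaches to the member** (inner twin of
`termFence_q_mem_reroute`). [cite: KestenSidoraviciusZhang1998, App. §7 (7.9) p. 27] -/
theorem int_termFence_q_mem_reroute (hm : 5 ≤ m) (hu : (intDom m).lowestSeq ω u = some (c, z))
    (hraw : IntRawOK m c z k ω) (hk : 1 ≤ k) (hkm : 64 * k < m) (hz8 : -(m : ℤ) + 8 * k < z 1 ∧ z 1 + 8 * k < 0)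
    (Tf : IntTermFence m c z k ω ↑c) {A : Set (Site 2)} {a : Site 2} (hft : τ.firstTerm A a = some u) :
    Tf.q ∈ τ.reroute A a := by
  have hcut := intDom_cutProp hm
  have hc := (JDomain.isCrossing_of_lowestSeq hu).1
  have hz := tip_isIntJ hc
  have hk' : (1 : ℤ) ≤ k := by exact_mod_cast hk
  have hq : Tf.q ∈ c := Finset.mem_coe.1 Tf.q_mem
  by_cases hpn : (m : ℤ) ≤ triNorm Tf.p
  · obtain ⟨j, hj, hpj⟩ := τ.int_isRight_of_mem_termFence hm hu hraw hk hkm hz8 Tf Tf.path.left_mem hpn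
    by_cases hqT : Tf.q ∈ τ.T
    · rw [τ.eq_jn_of_mem_term hcut hu hq hqT]
      exact jn_mem_reroute hft
    · have hqD : Tf.q ∈ ((↑(intDom m).D : Set (Site 2)) \ τ.T) :=
        ⟨by rw [intDom_D]; exact Finset.mem_coe.2 (hc.subset hq), hqT⟩
      exact mem_reroute_of_isRight hft hu hq ⟨j, hj, (PathIn.of_adj hqD hpj.left_mem Tf.adj).trans hpj⟩
  · push Not at hpn
    have hqT : Tf.q ∈ haFin m := by have := hc.subset hq; rwa [intDom_D] at this
    have hqb : triNorm Tf.q = m := by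
      have h1 := triNorm_le_triNorm_add_one_of_adj Tf.adj.symm
      have h2 := (mem_haFin.1 hqT).2.1
      omega
    have hbx := intFenceSet_box (Tf.F_subset Tf.path.left_mem)
    have hadj1 := triGraph_adj_coord Tf.adj 1
    have hqJ : Tf.q ∈ (intDom m).J := mem_intDom_J_of_near_tip hqT hqb hz hz8 hk ⟨by omega, by omega⟩
    rw [hc.eq_tip _ hq hqJ]
    exact tip_mem_reroute hcut hft hu

/-- **The inner fence misses its own member** (inner twin of `not_mem_reroute_of_mem_termFence`):
members are sets of sites of norm `≥ m` started outside `Λ_{2m}`. [cite: KestenSidoraviciusZhang1998, App. §7 (7.9) p. 27] -/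
theorem int_not_mem_reroute_of_mem_termFence (hm : 5 ≤ m) (hu : (intDom m).lowestSeq ω u = some (c, z))
    (hraw : IntRawOK m c z k ω) (hk : 1 ≤ k) (hkm : 64 * k < m) (hz8 : -(m : ℤ) + 8 * k < z 1 ∧ z 1 + 8 * k < 0)
    (Tf : IntTermFence m c z k ω ↑c) {A : Set (Site 2)} {a : Site 2} (hft : τ.firstTerm A a = some u)
    (hAn : ∀ v ∈ A, (m : ℤ) ≤ triNorm v) (han : 2 * (m : ℤ) < triNorm a) {x : Site 2} (hxF : x ∈ Tf.F) :
    x ∉ τ.reroute A a := by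
  intro hxr
  have hcut := intDom_cutProp hm
  rcases (mem_reroute_iff hft).1 hxr with hxc | hxt
  · have hxn := hAn x (comp_subset hxc)
    have hxD : x ∈ (intDom m).D := by rw [intDom_D]; exact (mem_intFenceSet_inside (Tf.F_subset hxF) hxn).1
    have hl := isLeft_of_mem_comp (not_mem_intDom_D_of_gt han) (intDom_entry hAn) hxc hxD
    exact τ.not_isRight_of_isLeft hcut hl (τ.int_isRight_of_mem_termFence hm hu hraw hk hkm hz8 Tf hxF hxn)
  · exact intFenceSet_disjoint (Tf.F_subset hxF) (tail_subset_term hu hxt)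

/-- **No invasion of inner fence zones** (inner twin of `not_mem_of_mem_termFence`): with `R'`
any open set of sites of norm `≥ m`, `𝕋`-connected from a site `a'` of norm `> 2m`, disjoint from
`τ.reroute A a`, the connection `Tf.F` misses `R'`. [cite: KestenSidoraviciusZhang1998, App. §7 (7.9) p. 27] -/
theorem int_not_mem_of_mem_termFence (hm : 5 ≤ m) (hu : (intDom m).lowestSeq ω u = some (c, z))
    (hraw : IntRawOK m c z k ω) (hk : 1 ≤ k) (hkm : 64 * k < m) (hz8 : -(m : ℤ) + 8 * k < z 1 ∧ z 1 + 8 * k < 0)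
    (Tf : IntTermFence m c z k ω ↑c) {A : Set (Site 2)} {a : Site 2} (hft : τ.firstTerm A a = some u)
    {R' : Set (Site 2)} (hR'ω : R' ⊆ ω) (hR'n : ∀ v ∈ R', (m : ℤ) ≤ triNorm v) {a' : Site 2}
    (ha'n : 2 * (m : ℤ) < triNorm a') (hconn' : ∀ x ∈ R', PathIn triGraph R' a' x)
    (hdisj : Disjoint R' (τ.reroute A a)) {x : Site 2} (hxF : x ∈ Tf.F) : x ∉ R' := by
  intro hxR
  have hcut := intDom_cutProp hm
  have hc := (JDomain.isCrossing_of_lowestSeq hu).1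
  have hz := tip_isIntJ hc
  obtain ⟨hz0, hz1, hz2⟩ := hz
  have hk' : (1 : ℤ) ≤ k := by exact_mod_cast hk
  have hxn := hR'n x hxR
  have hxr : τ.IsRight x := τ.int_isRight_of_mem_termFence hm hu hraw hk hkm hz8 Tf hxF hxn
  have hxin := mem_intFenceSet_inside (Tf.F_subset hxF) hxn
  have hxbox := intFenceSet_box (Tf.F_subset hxF)
  set L : Set (Site 2) := ((↑((intDom m).lower c z) : Set (Site 2)))ᶜ with hL
  have hxL : x ∈ L := fun h =>
    (JDomain.mem_lower_iff_not_mem_above (show x ∈ (intDom m).D from by rw [intDom_D]; exact hxin.1)).1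
      (Finset.mem_coe.1 h) hxin.2.1
  have hfar := int_far_of_triNorm_gt (k := k) (by omega) ⟨hz0, hz1, hz2⟩ ha'n
  rcases (hconn' x hxR).symm.exit_or (R := L) hxL with hp | ⟨p, q, hpL, hqL, hqR, hpq, hp⟩
  · exact hraw.inner_ring hk ⟨by omega, by omega, by omega, by omega⟩ hfar (hp.mono fun v hv => ⟨hv.1, hR'ω hv.2⟩)
  · obtain ⟨S, hS, hSp, hSall⟩ := hp.exists_support
    have hSin : ∀ v ∈ S, v ∈ (intDom m).above c z ∧ v ∉ τ.T := by
      intro v hv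
      have hvL : v ∈ L := (hS hv).1
      have hvR : v ∈ R' := (hS hv).2
      have hvω := hR'ω hvR
      have hvbox : ¬ (v 0 ≤ z 0 - 7 * k ∨ z 0 + 7 * k ≤ v 0 ∨ v 1 ≤ z 1 - 7 * k ∨ z 1 + 7 * k ≤ v 1) :=
        fun hout => hraw.inner_ring hk ⟨by omega, by omega, by omega, by omega⟩ hout
          ((hSall v hv).mono fun w hw => ⟨(hS hw).1, hR'ω (hS hw).2⟩)
      push Not at hvbox
      have hvT : v ∈ haFin m := mem_haFin_of_near (k := k) (by omega) ⟨hz0, hz1, hz2⟩ (hR'n v hvR) hvbox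
      have hva : v ∈ (intDom m).above c z := by
        by_contra hva
        exact hvL (Finset.mem_coe.2 ((JDomain.mem_lower_iff_not_mem_above
          (show v ∈ (intDom m).D from by rw [intDom_D]; exact hvT)).2 hva))
      exact ⟨hva, τ.int_not_mem_T_near_tip hm hu hraw hk hkm hva hvω ⟨by omega, by omega, by omega, by omega⟩⟩
    have hpath : PathIn triGraph ((↑(intDom m).D : Set (Site 2)) \ τ.T) x p :=
      hSp.mono fun v hv => ⟨by rw [intDom_D]; exact Finset.mem_coe.2 (JDomain.above_subset_D (hSin v hv).1),
        (hSin v hv).2⟩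
    have hpr : τ.IsRight p := τ.isRight_of_pathIn hpath.symm hxr
    have hpa : p ∈ (intDom m).above c z := (hSin p hSp.right_mem).1
    have hql : q ∈ (intDom m).lower c z := Finset.mem_coe.1 (not_not.1 hqL)
    have hqc : q ∈ c := by
      rcases JDomain.mem_lower.1 hql with h | h
      · exact h
      · exact absurd hpq (JDomain.not_adj_above_below hpa h)
    have hqmem : q ∈ τ.reroute A a := by
      by_cases hqT : q ∈ τ.T
      · rw [τ.eq_jn_of_mem_term hcut hu hqc hqT]
        exact jn_mem_reroute hft
      · have hqD : q ∈ ((↑(intDom m).D : Set (Site 2)) \ τ.T) :=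
          ⟨by rw [intDom_D]; exact Finset.mem_coe.2 (hc.subset hqc), hqT⟩
        exact mem_reroute_of_isRight hft hu hqc
          (τ.isRight_of_pathIn (PathIn.of_adj hqD hpath.right_mem hpq.symm) hpr)
    exact Set.disjoint_left.1 hdisj hqR hqmem

end JDomain.Transversal

/-- **Inner fences of two terms of one frame are disjoint, the higher more than `17k` rows up**
(inner twin of `termFence_disjoint_of_lt`; `64k < m`). [cite: Nolin2008, §4.4 Lemma 15 (proof), internal extremities (arXiv 0711.4948: Lemma 14)] -/
theorem intTermFence_disjoint_of_lt (hm : 5 ≤ m) {u w k' : ℕ} {c c' : Finset (Site 2)} {z z' : Site 2} (huw : u < w)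
    (hu : (intDom m).lowestSeq ω u = some (c, z)) (hw : (intDom m).lowestSeq ω w = some (c', z'))
    (hraw : IntRawOK m c z k ω) (hk : 1 ≤ k) (hkm : 64 * k < m) (hz8 : -(m : ℤ) + 8 * k < z 1 ∧ z 1 + 8 * k < 0)
    (Tf : IntTermFence m c z k ω ↑c) (Tf' : IntTermFence m c' z' k' ω ↑c') :
    Disjoint Tf.F Tf'.F ∧ z 1 + 17 * k < z' 1 := by
  have hcut := intDom_cutProp hm
  have hc := (JDomain.isCrossing_of_lowestSeq hu).1
  obtain ⟨hc', hc'ω⟩ := JDomain.isCrossing_of_lowestSeq hw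
  have hz := tip_isIntJ hc
  have hk' : (1 : ℤ) ≤ k := by exact_mod_cast hk
  have htk : -(m : ℤ) + 2 * k + 1 ≤ z 1 ∧ z 1 ≤ -(2 * (k : ℤ) + 1) := by constructor <;> omega
  have habove : c' ⊆ (intDom m).above c z := JDomain.lowestSeq_subset_above_of_lt hcut huw hu hw
  have hoff : ∀ v ∈ c', v ∉ (intDom m).lower c z := fun v hv hvl =>
    (JDomain.mem_lower_iff_not_mem_above (hc'.subset hv)).1 hvl (habove hv)
  have hlt : z 1 < z' 1 := JDomain.ht_lowestSeq_lt_of_lt hcut huw hu hw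
  have hgap : z 1 + 17 * k < z' 1 := hraw.row_gap hk (by omega) hc hc' hc'ω hoff hlt
  refine ⟨Set.disjoint_left.2 fun x hx hx' => ?_, hgap⟩
  by_cases hxn : (m : ℤ) ≤ triNorm x
  · have hxa' : x ∈ (intDom m).above c' z' := (mem_intFenceSet_inside (Tf'.F_subset hx') hxn).2.1
    have hdisj : ∀ v ∈ Tf.F, v ∉ c' := fun v hv =>
      Tf.not_mem_of_offLower hraw hk (by omega) hc hc' hc'ω hoff hv
    exact Tf.not_mem_above_of_row_lt hm hk hz htk hc' (by omega) hdisj hx hxn hxa'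
  · push Not at hxn
    have h1 := mem_intFenceSet_beyond (Tf'.F_subset hx') hxn
    have h2 := (intFenceSet_box (Tf.F_subset hx)).2.2.2
    omega

/-- The inner fence of a term misses every other term of its frame (`64k < m`). [cite: Nolin2008, §4.4 Lemma 15 (proof), internal extremities (arXiv 0711.4948: Lemma 14)] -/
theorem intTermFence_not_mem_term (hm : 5 ≤ m) {u w : ℕ} {c c' : Finset (Site 2)} {z z' : Site 2} (huw : u ≠ w)
    (hu : (intDom m).lowestSeq ω u = some (c, z)) (hw : (intDom m).lowestSeq ω w = some (c', z'))
    (hraw : IntRawOK m c z k ω) (hk : 1 ≤ k) (hkm : 64 * k < m)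
    (Tf : IntTermFence m c z k ω ↑c) {x : Site 2} (hx : x ∈ Tf.F) : x ∉ c' := by
  have hcut := intDom_cutProp hm
  have hc := (JDomain.isCrossing_of_lowestSeq hu).1
  rcases Nat.lt_or_gt_of_ne huw with hlt | hgt
  · obtain ⟨hc', hc'ω⟩ := JDomain.isCrossing_of_lowestSeq hw
    have habove : c' ⊆ (intDom m).above c z := JDomain.lowestSeq_subset_above_of_lt hcut hlt hu hw
    have hoff : ∀ v ∈ c', v ∉ (intDom m).lower c z := fun v hv hvl =>
      (JDomain.mem_lower_iff_not_mem_above (hc'.subset hv)).1 hvl (habove hv)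
    exact Tf.not_mem_of_offLower hraw hk (by omega) hc hc' hc'ω hoff hx
  · exact Tf.not_mem_of_subset_below (JDomain.lowestSeq_subset_below_of_lt hcut hgt hw hu) hx

end Literature.Probability.Percolation
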